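import Mathlib.Analysis.Calculus.ContDiff.Basic
import Mathlib.Analysis.InnerProductSpace.PiL2
import Mathlib.LinearAlgebra.BilinearForm.IsometryEquiv
import Literature.Geometry.Lorentzian.KerrData
import Literature.Geometry.Lorentzian.Causality
import HarnessLib

-- provenance: harness21/H21/H21/Prelude/Lorentz/KerrConvergence.lean @ 2b5b74a (interim HEAD d8f2665); M5 mechanical rewrite
/-!
# Convergence to a nearby Kerr solution / to Minkowski space (trunk G08 = T-LORENTZ, item C24)

Family `gr`, notion `asymptotic_stability_convergence` (tier L). Restricted *real* definitions
of the phrases "the spacetime converges, in the region `𝒟`, to a nearby member of the Kerr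
family" (Dafermos–Holzegel–Rodnianski–Taylor, arXiv:2104.08222, §1; Klainerman–Szeftel,
Pure Appl. Math. Q. 19 (2023), Thm. 1.1; Giorgi–Klainerman–Szeftel arXiv:2205.14808) and
"converges to Minkowski space" (Christodoulou–Klainerman 1993, Thm. 1.0.2 / 10.2.1;
Lindblad–Rodnianski, Ann. Math. 171 (2010), Thm. 1.1), plus a *hypothesis structure* for the
conjectural `N`-black-hole final state (final state conjecture; Penrose 1982, Klainerman,
"Brief history of the black hole stability problem", §4).

## The notion, and why it is a paraphrase (OUTLINE §4.4)

The printed theorems measure decay in a dynamically constructed double-null (DHRT) or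
principal-temporal / GCM (KS, GKS) gauge, by weighted energies of Ricci coefficients and
curvature components. None of that gauge machinery is formalisable at tier L. We state instead
the common **consequence form**: there is a *late-time chart* — a smooth open embedding `Ψ` of
the late part `{t* > τ₀}` of a reference background `(U ⊆ E4, g₀)` (Kerr exterior in ingoing
Kerr–Schild Cartesian coordinates, Minkowski space, or a boosted/translated Kerr exterior)
into the spacetime, covering the late part of `𝒟` — in which the unweighted `Cᵏ` sup norm,
over the coordinate slabs `{t* = τ}`, of the deviation `Ψ^* g − g₀` of the pulled-back metric
from the reference metric tends to `0` as `τ → ∞` (`Spacetime.ConvergesTo`), or stays `≤ ε`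
(`Spacetime.RemainsCloseTo`). Because the reference domains are open subsets of `E4`, whose
tangent spaces are `E4` definitionally, the deviation is an honest map into the normed space
`E4 →L[ℝ] E4 →L[ℝ] ℝ` (operator norm) and its derivatives are Mathlib's `iteratedFDeriv` of the
extension by zero (`Function.extend Subtype.val · 0`, as in `Literature.Prelude.Lorentz.WeightedNorms`).

## Contents (namespace `Literature.Lorentz`)

* generic layer: `ModelBackground` (`domain : Opens E4`, `bilin`, `time`, `radius`),
  `ModelBackground.lateRegion/timeSlab/truncTimeSlab/truncLateRegion`, `supCkENorm`,
  `Spacetime.deviation`, `Spacetime.deviationCk`, `Spacetime.truncDeviationCk`,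
  `Spacetime.IsLateChart`, `Spacetime.IsLateEmbedding`, `Spacetime.ConvergesTo`,
  `Spacetime.RemainsCloseTo`;
* Kerr: `Kerr.background`, `Kerr.lateRegion`, `Kerr.timeSlab`, `Spacetime.metricDeviation`,
  `Spacetime.ConvergesToKerr`, `Spacetime.RemainsCloseToKerr`;
* Minkowski (review F3, no puncture: the domain is all of `E4`): `Minkowski.backgroundOn`,
  `Minkowski.background`, `Minkowski.lateRegion`, `Minkowski.timeSlab`,
  `Spacetime.minkowskiDeviation`, `Spacetime.ConvergesToMinkowski`,
  `Spacetime.RemainsCloseToMinkowski`;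
* moving black holes: `lorentzGroup : Subgroup (E4 ≃L[ℝ] E4)` (with
  `lorentzGroup.isometryEquiv` into Mathlib's `LinearMap.BilinForm.IsometryEquiv`),
  `poincareInv`, `boostedKerrExterior`, `boostedKerrBilin`, `boostedKerrBackground`,
  `Spacetime.ConvergesToBoostedKerr`, and the hypothesis structure `FinalStateDecomposition`
  with its sanity API (`region`, `radiationZone`, `lateRegion_subset_flatDomain_of_N_eq_zero`,
  `diff_radiationZone_subset_of_N_eq_zero`, `convergesToMinkowski_of_N_eq_zero`,
  `ofConvergesToMinkowski`, `nonempty_finalStateDecomposition_of_convergesToKerr`).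

## Mathlib

Mathlib has no Lorentz group (`rg -i lorentzgroup` is empty; the Lorentz group of `PhysLean` is
not part of Mathlib), no Kerr metric and no notion of asymptotic stability of spacetimes. We use
`TopologicalSpace.Opens` (open submanifolds of `E4`), `Topology.IsOpenEmbedding`, `ContMDiff`,
`iteratedFDeriv`, `‖·‖ₑ`, `Filter.Tendsto … atTop (𝓝 0)`, the group structure
`ContinuousLinearEquiv.automorphismGroup` on `E4 ≃L[ℝ] E4`, `Subgroup`, and
`LinearMap.BilinForm.IsometryEquiv` (`Mathlib/LinearAlgebra/BilinearForm/IsometryEquiv.lean`)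
to certify that `lorentzGroup` consists of `η`-isometries in Mathlib's sense. From H21 we use
`pullbackBilin` (`Isometry`), `Kerr.exterior`, `Kerr.bilin`, `Minkowski.bilin` (`KerrSchild`),
`LorentzianMetric.causalPast` (`Causality`) and `Spacetime` (`LorentzianMetric`).

## Design choices

* **One generic layer, three specialisations.** Kerr, Minkowski and boosted Kerr differ only in
  the reference triple `(domain, bilin, time)`; we bundle it as `ModelBackground` and define the
  planned names as thin specialisations (Mathlib-style generality at no cost).
* **Unweighted sup norms (deviation from the outline).** The outline suggested the weight
  `‖x‖^m` on the `m`-th derivative. On the asymptotically flat slabs `{t* = τ}` (which reach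
  spatial infinity `i⁰`) this is *false* in consequence form already for linear waves
  (`r ∂(f(u)/r) ≈ f'(u)` does not decay along `{t* = τ} ∋ (u fixed, r ≈ τ/2)`), and the
  Euclidean norm `‖x‖` of a point of the slab grows like `τ`. Every sorried/hypothesised
  statement must be true, so `deviationCk` is the plain `Cᵏ` sup norm
  `sup_{m ≤ k} sup_{slab} ‖D^m(Ψ^*g − g₀)‖`, which does tend to `0` for the theorems cited
  (pointwise decay `≲ τ^{-δ}` in the near region, `≲ r^{-1}` near `i⁰`).
* **`𝒟` is a parameter.** The covering condition `𝒟 \ Ψ(late region) ⊆ J⁻(Ψ(slab τ₀))` is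
  meant for `𝒟` = the exterior part (past of null infinity / domain of outer communications)
  of a development; black-hole interior points are neither covered nor in that causal past.
  Statement files choose `𝒟`.
* **Smoothness of `Ψ` on the whole reference domain** (not only on the late region) is a
  harmless normalisation: `{t* > τ₀ + 1}` is a deformation retract of the domain along `t*`.
* **Boosted Kerr.** `boostedKerrBilin Λ c M a` is the pullback of the Kerr–Schild form under
  the inverse Poincaré map `x ↦ Λ⁻¹ (x − c)`; since `Kerr.bilin M a` is a total function on
  `E4`, no junk branch is needed — only its values on `boostedKerrExterior Λ c M a`
  (the Poincaré image of `Kerr.exterior M a`) are meaningful. The time function of the boosted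
  background is the rest-frame Kerr–Schild time `(Λ⁻¹ (x − c))⁰`.
* **`FinalStateDecomposition` (no printed `N ≥ 2` formulation exists).** The final state
  conjecture for `N` black holes is folklore (Penrose 1982; Klainerman, §4): the late-time
  geometry of `𝒟` decomposes into `N` black-hole regions, each converging to a boosted,
  translated Kerr exterior, the holes receding from each other, plus a radiation zone
  converging to Minkowski space. We record this as a hypothesis structure built from the
  generic layer: `N + 1` late-time charts (`IsLateChart`: smooth, open embedding of the late
  region, image in `𝒟`) after a common time `τ₀` — `N` on boosted Kerr exteriors and one on a
  flat domain `flatDomain : Opens E4` with the Minkowski background — together with **one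
  global covering clause** (the part of `𝒟` not charted lies in `J⁻` of the images of the
  initial slabs) and the following convergence clauses. (i) For each hole, the `Cᵏ` deviation
  from boosted Kerr tends to `0` on every *radially truncated* slab `{t*ᵢ = τ, rᵢ ≤ R}`
  (`truncDeviationCk`; review item 2: with `N ≥ 2` untruncated sup-norm convergence out to
  `rᵢ = ∞` on pairwise separated charts is not the intended notion, since the far field of hole
  `i` sees the other holes at size `O(1)`; truncated convergence for every `R` plus a flat chart
  is the standard "near zones + radiation zone" picture). (ii) The holes **separate**: for
  every `R` there is `τ₁` after which the truncated world-tubes `Ψᵢ({t*ᵢ > τ₁, rᵢ ≤ R})` are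
  pairwise disjoint (inventory gr.S01: "separations → ∞"). (iii) The flat domain contains the
  late half-space `{x⁰ > τ₀}` minus excised tubes `{rᵢ(Λᵢ⁻¹(x − cᵢ)) ≤ ρᵢ(x⁰)}` of
  *sublinear* radii `ρᵢ = o(t)` around the straight world-lines `t ↦ Λᵢ(t, 0) + cᵢ` of the
  holes (this is what gives the motions `(Λᵢ, cᵢ)` a meaning in the common flat chart; any
  `ρᵢ → ∞`, `ρᵢ = o(t)` accommodates the `O(Mᵢ/ρᵢ)` far fields and even parabolic `t^{2/3}`
  drifts), and on the flat chart the full `Cᵏ` deviation from `η` tends to `0`. Sanity: for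
  `N = 0` the flat domain contains the whole late half-space
  (`lateRegion_subset_flatDomain_of_N_eq_zero`), so no time-bounded/empty flat domain can
  make the convergence vacuous (review item 1), and with `flatDomain = ⊤` the structure is
  exactly `ConvergesToMinkowski 𝒟 k` (`convergesToMinkowski_of_N_eq_zero`,
  `ofConvergesToMinkowski`); `ConvergesToKerr` with `0 < M`, `|a| ≤ M` yields an `N = 1`
  decomposition (`nonempty_finalStateDecomposition_of_convergesToKerr`). `k` is a parameter
  (deviation from the outline's `FinalStateDecomposition 𝓢 𝒟`) so that gr.S01 can quantify
  over it.

## References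

* M. Dafermos, G. Holzegel, I. Rodnianski, M. Taylor, *The non-linear stability of the
  Schwarzschild family of black holes*, arXiv:2104.08222, §1.
* S. Klainerman, J. Szeftel, *Kerr stability for small angular momentum*, Pure Appl. Math. Q.
  19 (2023), Thm. 1.1; E. Giorgi, S. Klainerman, J. Szeftel, arXiv:2205.14808.
* D. Christodoulou, S. Klainerman, *The global nonlinear stability of the Minkowski space*,
  Princeton 1993, Thm. 1.0.2; H. Lindblad, I. Rodnianski, Ann. Math. 171 (2010), Thm. 1.1.
* R. Penrose, *Some unsolved problems in classical general relativity* (1982), Problem 12;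
  S. Klainerman, *Brief history of the black hole stability problem*, §4 (final state
  conjecture).
* B. O'Neill, *Semi-Riemannian geometry*, 1983, Ch. 9, pp. 233–236 (Lorentz group).
-/

noncomputable section

open TopologicalSpace Manifold Filter Topology
open scoped ContDiff Topology ENNReal

universe u

namespace Literature.Geometry.Lorentzian

/-! ### `Cᵏ` sup norms -/

section SupNorm

variable {F G : Type*} [NormedAddCommGroup F] [NormedSpace ℝ F] [NormedAddCommGroup G]
  [NormedSpace ℝ G]

/-- The **`Cᵏ` sup (extended) norm** of `f : F → G` over `S ⊆ F`:
`sup_{m ≤ k} sup_{x ∈ S} ‖D^m f (x)‖ ∈ [0, ∞]`, with Mathlib's `iteratedFDeriv` (classical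
derivative; only smooth `f` on open neighbourhoods of `S` are intended). The unweighted case of
`weightedCkSeminorm` (Bartnik, CPAM 39 (1986), (1.3)); DHRT arXiv:2104.08222, §1 (pointwise
norms of the metric deviation). [cite: arXiv210408222] -/
def supCkENorm (S : Set F) (k : ℕ) (f : F → G) : ℝ≥0∞ :=
  ⨆ (m : ℕ) (_ : m ≤ k), ⨆ x ∈ S, ‖iteratedFDeriv ℝ m f x‖ₑ

/-- The `Cᵏ` sup norm of the zero function vanishes (Bartnik 1986, (1.3)). [cite: Bartnik1986, (1.3] -/
@[simp]
theorem supCkENorm_zero (S : Set F) (k : ℕ) : supCkENorm S k (0 : F → G) = 0 := by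
  simp [supCkENorm, enorm_eq_nnnorm]

/-- The `Cᵏ` sup norm is monotone in the set (Bartnik 1986, (1.3)). [cite: Bartnik1986, (1.3] -/
theorem supCkENorm_mono {S T : Set F} (h : S ⊆ T) (k : ℕ) (f : F → G) :
    supCkENorm S k f ≤ supCkENorm T k f :=
  iSup₂_mono fun _ _ ↦ iSup_le_iSup_of_subset h

/-- The `Cᵏ` sup norm is monotone in `k` (Bartnik 1986, (1.3)). [cite: Bartnik1986, (1.3] -/
theorem supCkENorm_mono_right (S : Set F) {k k' : ℕ} (h : k ≤ k') (f : F → G) :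
    supCkENorm S k f ≤ supCkENorm S k' f :=
  iSup_mono fun _ ↦ iSup_const_mono fun hm ↦ hm.trans h

/-- Pointwise bound: `‖D^m f (x)‖ ≤ supCkENorm S k f` for `m ≤ k`, `x ∈ S`
(Bartnik 1986, (1.3)). [cite: Bartnik1986, (1.3] -/
theorem enorm_iteratedFDeriv_le_supCkENorm {S : Set F} {k m : ℕ} (hm : m ≤ k) {x : F}
    (hx : x ∈ S) (f : F → G) : ‖iteratedFDeriv ℝ m f x‖ₑ ≤ supCkENorm S k f :=
  le_iSup₂_of_le m hm (le_iSup₂_of_le x hx le_rfl)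

end SupNorm

/-! ### Reference backgrounds in a global chart of `E4` -/

/-- A **reference background** for asymptotic-stability statements: an open domain
`U ⊆ E4 = ℝ⁴` (an open submanifold, model `𝓘(ℝ, E4)`, tangent spaces `= E4`), a family of
continuous bilinear forms `g₀(x)` on `E4` (the reference metric in the global chart; only its
values on `U` matter), a time function `t` on `E4` whose level sets `{t = τ} ∩ U` are the
slabs along which decay is measured, and a radius function `r` on `E4` used to truncate slabs
(`{t = τ, r ≤ R}`, the "near zone"). Instances: Kerr exterior in ingoing Kerr–Schild
coordinates (`Kerr.background`), Minkowski space (`Minkowski.background`), boosted Kerr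
(`boostedKerrBackground`). DHRT arXiv:2104.08222, §1; Klainerman–Szeftel, PAMQ 19 (2023),
Thm. 1.1 (consequence-form paraphrase, see the module docstring). [cite: arXiv210408222] -/
structure ModelBackground where
  /-- The coordinate domain `U ⊆ E4` of the reference solution. -/
  domain : Opens E4
  /-- The reference metric components `g₀(x) : E4 →L[ℝ] E4 →L[ℝ] ℝ`. -/
  bilin : E4 → E4 →L[ℝ] E4 →L[ℝ] ℝ
  /-- The coordinate time function `t : E4 → ℝ`. -/
  time : E4 → ℝ
  /-- The coordinate radius function `r : E4 → ℝ` (Kerr–Schild `r`, resp. `|x̲|`). -/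
  radius : E4 → ℝ

namespace ModelBackground

/-- The **late region** `{x ∈ U | τ₀ < t(x)}` of a reference background (DHRT
arXiv:2104.08222, §1: the region `{t* ≥ τ₀}` of the Kerr exterior). [cite: arXiv210408222] -/
def lateRegion (B : ModelBackground) (τ₀ : ℝ) : Set B.domain := {x | τ₀ < B.time x.1}

/-- The **time slab** `{x ∈ U | t(x) = τ}` of a reference background (DHRT arXiv:2104.08222,
§1: the hypersurfaces `{t* = τ}`). [cite: arXiv210408222] -/
def timeSlab (B : ModelBackground) (τ : ℝ) : Set B.domain := {x | B.time x.1 = τ}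

/-- Membership in the late region (DHRT arXiv:2104.08222, §1). [cite: arXiv210408222] -/
@[simp]
theorem mem_lateRegion {B : ModelBackground} {τ₀ : ℝ} {x : B.domain} :
    x ∈ B.lateRegion τ₀ ↔ τ₀ < B.time x.1 := Iff.rfl

/-- Membership in a time slab (DHRT arXiv:2104.08222, §1). [cite: arXiv210408222] -/
@[simp]
theorem mem_timeSlab {B : ModelBackground} {τ : ℝ} {x : B.domain} :
    x ∈ B.timeSlab τ ↔ B.time x.1 = τ := Iff.rfl

/-- Late regions shrink as `τ₀` grows (DHRT arXiv:2104.08222, §1). [cite: arXiv210408222] -/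
theorem lateRegion_mono (B : ModelBackground) {τ₀ τ₁ : ℝ} (h : τ₀ ≤ τ₁) :
    B.lateRegion τ₁ ⊆ B.lateRegion τ₀ := fun _ hx ↦ lt_of_le_of_lt h hx

/-- Later slabs lie in the late region (DHRT arXiv:2104.08222, §1). [cite: arXiv210408222] -/
theorem timeSlab_subset_lateRegion (B : ModelBackground) {τ₀ τ : ℝ} (h : τ₀ < τ) :
    B.timeSlab τ ⊆ B.lateRegion τ₀ := fun _ hx ↦ by
  rw [mem_timeSlab] at hx
  rw [mem_lateRegion, hx]
  exact h

/-- The **truncated time slab** `{x ∈ U | t(x) = τ, r(x) ≤ R}` (near zone of radius `R` on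
the slab `{t = τ}`; DHRT arXiv:2104.08222, §1, the region `{r ≤ R}` where `τ^{-δ}` decay is
measured). [cite: arXiv210408222] -/
def truncTimeSlab (B : ModelBackground) (R τ : ℝ) : Set B.domain :=
  {x | B.time x.1 = τ ∧ B.radius x.1 ≤ R}

/-- The **truncated late region** (world-tube) `{x ∈ U | τ₁ < t(x), r(x) ≤ R}`
(DHRT arXiv:2104.08222, §1). [cite: arXiv210408222] -/
def truncLateRegion (B : ModelBackground) (τ₁ R : ℝ) : Set B.domain :=
  {x | τ₁ < B.time x.1 ∧ B.radius x.1 ≤ R}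

/-- Membership in a truncated time slab (DHRT arXiv:2104.08222, §1). [cite: arXiv210408222] -/
@[simp]
theorem mem_truncTimeSlab {B : ModelBackground} {R τ : ℝ} {x : B.domain} :
    x ∈ B.truncTimeSlab R τ ↔ B.time x.1 = τ ∧ B.radius x.1 ≤ R := Iff.rfl

/-- Membership in a truncated late region (DHRT arXiv:2104.08222, §1). [cite: arXiv210408222] -/
@[simp]
theorem mem_truncLateRegion {B : ModelBackground} {τ₁ R : ℝ} {x : B.domain} :
    x ∈ B.truncLateRegion τ₁ R ↔ τ₁ < B.time x.1 ∧ B.radius x.1 ≤ R := Iff.rfl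

/-- Truncated slabs lie in the full slab (DHRT arXiv:2104.08222, §1). [cite: arXiv210408222] -/
theorem truncTimeSlab_subset_timeSlab (B : ModelBackground) (R τ : ℝ) :
    B.truncTimeSlab R τ ⊆ B.timeSlab τ := fun _ hx ↦ hx.1

/-- Truncated slabs grow with `R` (DHRT arXiv:2104.08222, §1). [cite: arXiv210408222] -/
theorem truncTimeSlab_mono (B : ModelBackground) {R R' : ℝ} (h : R ≤ R') (τ : ℝ) :
    B.truncTimeSlab R τ ⊆ B.truncTimeSlab R' τ := fun _ hx ↦ ⟨hx.1, hx.2.trans h⟩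

/-- The full slab is the union of its truncations (DHRT arXiv:2104.08222, §1). [cite: arXiv210408222] -/
theorem iUnion_truncTimeSlab (B : ModelBackground) (τ : ℝ) :
    ⋃ R : ℝ, B.truncTimeSlab R τ = B.timeSlab τ :=
  Set.Subset.antisymm (Set.iUnion_subset fun R ↦ B.truncTimeSlab_subset_timeSlab R τ)
    fun x hx ↦ Set.mem_iUnion.mpr ⟨B.radius x.1, hx, le_rfl⟩

/-- Truncated late regions lie in the late region (DHRT arXiv:2104.08222, §1). [cite: arXiv210408222] -/
theorem truncLateRegion_subset_lateRegion (B : ModelBackground) (τ₁ R : ℝ) :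
    B.truncLateRegion τ₁ R ⊆ B.lateRegion τ₁ := fun _ hx ↦ hx.1

end ModelBackground

/-! ### Deviation of a pulled-back metric from a reference background; convergence -/

namespace Spacetime

variable (𝓢 : Spacetime.{u} 4) (B : ModelBackground)

/-- The **metric deviation** `(Ψ^* g − g₀)(x) : E4 →L[ℝ] E4 →L[ℝ] ℝ` at `x ∈ U` of the
pullback of the spacetime metric `g = 𝓢.metric` along a chart map `Ψ : U → 𝓢.carrier` from
the reference metric `g₀ = B.bilin` (the tangent space of the open submanifold `U ⊆ E4` at `x`
is `E4` definitionally, so this is a genuine continuous bilinear map with its operator norm).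
DHRT arXiv:2104.08222, §1 (`g − g_{a,M}`); Klainerman–Szeftel, PAMQ 19 (2023), Thm. 1.1. [cite: arXiv210408222] -/
def deviation (Ψ : B.domain → 𝓢.carrier) (x : B.domain) : E4 →L[ℝ] E4 →L[ℝ] ℝ :=
  (show E4 →L[ℝ] E4 →L[ℝ] ℝ from
      pullbackBilin (I := 𝓡 4) (I' := 𝓘(ℝ, E4)) Ψ 𝓢.metric.val x) - B.bilin x.1

/-- Unfolding lemma: `deviation 𝓢 B Ψ x v w = g(dΨ v, dΨ w) − g₀(x)(v, w)`
(DHRT arXiv:2104.08222, §1). [cite: arXiv210408222] -/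
theorem deviation_apply (Ψ : B.domain → 𝓢.carrier) (x : B.domain) (v w : E4) :
    𝓢.deviation B Ψ x v w =
      𝓢.metric.val (Ψ x) (mfderiv 𝓘(ℝ, E4) (𝓡 4) Ψ x v) (mfderiv 𝓘(ℝ, E4) (𝓡 4) Ψ x w) -
        B.bilin x.1 v w :=
  rfl

/-- The metric deviation extended by zero to all of `E4` (`Function.extend Subtype.val · 0`,
as in `WeightedNorms`), so that Mathlib's `iteratedFDeriv ℝ m` applies; on the open set `U`
its derivatives are the honest coordinate derivatives of `Ψ^* g − g₀`.
DHRT arXiv:2104.08222, §1. [cite: arXiv210408222] -/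
def deviationExtend (Ψ : B.domain → 𝓢.carrier) : E4 → E4 →L[ℝ] E4 →L[ℝ] ℝ :=
  Function.extend Subtype.val (𝓢.deviation B Ψ) 0

/-- On the domain, the extension agrees with the deviation (DHRT arXiv:2104.08222, §1). [cite: arXiv210408222] -/
@[simp]
theorem deviationExtend_coe (Ψ : B.domain → 𝓢.carrier) (x : B.domain) :
    𝓢.deviationExtend B Ψ x = 𝓢.deviation B Ψ x :=
  Subtype.val_injective.extend_apply _ _ x

/-- Off the domain, the extension is the junk value `0` (never used; cf. `WeightedNorms`,
`InitialDataSet.hFun_of_not_mem`). DHRT arXiv:2104.08222, §1. [cite: arXiv210408222] -/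
theorem deviationExtend_of_not_mem (Ψ : B.domain → 𝓢.carrier) {y : E4} (hy : y ∉ B.domain) :
    𝓢.deviationExtend B Ψ y = 0 := by
  rw [deviationExtend, Function.extend_apply']
  · rfl
  · rintro ⟨x, rfl⟩
    exact hy x.2

/-- The **`Cᵏ` deviation on the slab `{t = τ}`**:
`sup_{m ≤ k} sup_{x ∈ U, t(x) = τ} ‖D^m (Ψ^* g − g₀)(x)‖ ∈ [0, ∞]` (unweighted; see the module
docstring for why the outline's weight `‖x‖^m` was dropped). DHRT arXiv:2104.08222, §1
(pointwise decay of `g − g_{a,M}` and its derivatives); Klainerman–Szeftel, PAMQ 19 (2023),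
Thm. 1.1. [cite: arXiv210408222] -/
def deviationCk (Ψ : B.domain → 𝓢.carrier) (k : ℕ) (τ : ℝ) : ℝ≥0∞ :=
  supCkENorm (Subtype.val '' B.timeSlab τ) k (𝓢.deviationExtend B Ψ)

/-- `deviationCk` is monotone in `k` (DHRT arXiv:2104.08222, §1). [cite: arXiv210408222] -/
theorem deviationCk_mono (Ψ : B.domain → 𝓢.carrier) {k k' : ℕ} (h : k ≤ k') (τ : ℝ) :
    𝓢.deviationCk B Ψ k τ ≤ 𝓢.deviationCk B Ψ k' τ :=
  supCkENorm_mono_right _ h _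

/-- The **`Cᵏ` deviation on the truncated slab `{t = τ, r ≤ R}`** (near-zone `Cᵏ` sup norm
of `Ψ^* g − g₀`). DHRT arXiv:2104.08222, §1 (`τ^{-δ}` decay on `{r ≤ R}`);
Klainerman–Szeftel, PAMQ 19 (2023), Thm. 1.1. [cite: arXiv210408222] -/
def truncDeviationCk (Ψ : B.domain → 𝓢.carrier) (k : ℕ) (R τ : ℝ) : ℝ≥0∞ :=
  supCkENorm (Subtype.val '' B.truncTimeSlab R τ) k (𝓢.deviationExtend B Ψ)

/-- The truncated deviation is bounded by the full one (DHRT arXiv:2104.08222, §1). [cite: arXiv210408222] -/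
theorem truncDeviationCk_le_deviationCk (Ψ : B.domain → 𝓢.carrier) (k : ℕ) (R τ : ℝ) :
    𝓢.truncDeviationCk B Ψ k R τ ≤ 𝓢.deviationCk B Ψ k τ :=
  supCkENorm_mono (Set.image_mono (B.truncTimeSlab_subset_timeSlab R τ)) _ _

/-- The truncated deviation is monotone in `R` (DHRT arXiv:2104.08222, §1). [cite: arXiv210408222] -/
theorem truncDeviationCk_mono (Ψ : B.domain → 𝓢.carrier) (k : ℕ) {R R' : ℝ} (h : R ≤ R')
    (τ : ℝ) : 𝓢.truncDeviationCk B Ψ k R τ ≤ 𝓢.truncDeviationCk B Ψ k R' τ :=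
  supCkENorm_mono (Set.image_mono (B.truncTimeSlab_mono h τ)) _ _

/-- The full deviation is the supremum of the truncated ones (DHRT arXiv:2104.08222, §1). [cite: arXiv210408222] -/
theorem iSup_truncDeviationCk (Ψ : B.domain → 𝓢.carrier) (k : ℕ) (τ : ℝ) :
    ⨆ R : ℝ, 𝓢.truncDeviationCk B Ψ k R τ = 𝓢.deviationCk B Ψ k τ := by
  refine le_antisymm (iSup_le fun R ↦ 𝓢.truncDeviationCk_le_deviationCk B Ψ k R τ) ?_
  refine iSup₂_le fun m hm ↦ iSup₂_le fun y hy ↦ ?_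
  obtain ⟨x, hx, rfl⟩ := hy
  exact (enorm_iteratedFDeriv_le_supCkENorm hm
    (Set.mem_image_of_mem _ (show x ∈ B.truncTimeSlab (B.radius x.1) τ from ⟨hx, le_rfl⟩))
    _).trans (le_iSup (fun R ↦ 𝓢.truncDeviationCk B Ψ k R τ) (B.radius x.1))

/-- `Ψ : U → 𝓢.carrier` is a **late-time chart** into the region `𝒟 ⊆ 𝓢.carrier` modelled
on the background `B` after time `τ₀`: `Ψ` is smooth, restricts to an open topological
embedding of the late region `{t > τ₀}`, and maps the late region into `𝒟` (no covering
condition; see `IsLateEmbedding`). DHRT arXiv:2104.08222, §1; Klainerman–Szeftel, PAMQ 19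
(2023), Thm. 1.1. [cite: arXiv210408222] -/
structure IsLateChart (𝒟 : Set 𝓢.carrier) (τ₀ : ℝ) (Ψ : B.domain → 𝓢.carrier) : Prop where
  /-- `Ψ` is smooth on the reference domain. -/
  contMDiff : ContMDiff 𝓘(ℝ, E4) (𝓡 4) ∞ Ψ
  /-- `Ψ` restricted to the late region `{t > τ₀}` is an open embedding. -/
  isOpenEmbedding : IsOpenEmbedding ((B.lateRegion τ₀).restrict Ψ)
  /-- The late region is mapped into `𝒟`. -/
  image_subset : Ψ '' B.lateRegion τ₀ ⊆ 𝒟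

/-- `Ψ : U → 𝓢.carrier` is a **late-time embedding** for the region `𝒟 ⊆ 𝓢.carrier` modelled
on the background `B` after time `τ₀`: a late-time chart (`IsLateChart`) which moreover
covers the late part of `𝒟`, in the sense that every point of `𝒟` not in the image of the
late region lies in the causal past `J⁻(Ψ({t = τ₀}))` of the image of the initial late slab.
DHRT arXiv:2104.08222, §1 (the exterior region `{t* ≥ τ₀}` up to and including the event
horizon and null infinity); Klainerman–Szeftel, PAMQ 19 (2023), Thm. 1.1. [cite: arXiv210408222] -/
structure IsLateEmbedding (𝒟 : Set 𝓢.carrier) (τ₀ : ℝ) (Ψ : B.domain → 𝓢.carrier) : Prop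
    extends 𝓢.IsLateChart B 𝒟 τ₀ Ψ where
  /-- The rest of `𝒟` lies in the causal past of the image of the slab `{t = τ₀}`. -/
  diff_subset_causalPast :
    𝒟 \ Ψ '' B.lateRegion τ₀ ⊆ 𝓢.metric.causalPast 𝓢.timeOrientation (Ψ '' B.timeSlab τ₀)

/-- **Convergence to the background `B` in the region `𝒟`, in `Cᵏ`**: there are a time `τ₀`
and a late-time chart `Ψ` (`IsLateEmbedding`) in which the `Cᵏ` sup norm over the slabs
`{t = τ}` of the deviation `Ψ^* g − g₀` tends to `0` as `τ → ∞`. Consequence-form paraphrase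
of DHRT arXiv:2104.08222, §1 and Klainerman–Szeftel, PAMQ 19 (2023), Thm. 1.1 (module
docstring). [cite: arXiv210408222] -/
def ConvergesTo (𝒟 : Set 𝓢.carrier) (k : ℕ) : Prop :=
  ∃ (τ₀ : ℝ) (Ψ : B.domain → 𝓢.carrier), 𝓢.IsLateEmbedding B 𝒟 τ₀ Ψ ∧
    Tendsto (fun τ ↦ 𝓢.deviationCk B Ψ k τ) atTop (𝓝 0)

/-- **`ε`-closeness to the background `B` in the region `𝒟`, in `Cᵏ`** (orbital stability):
there are `τ₀` and a late-time chart `Ψ` in which the `Cᵏ` deviation on every slab `{t = τ}`,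
`τ ≥ τ₀`, is at most `ε`. Here `ε : ℝ≥0∞`, the natural codomain of `deviationCk`
(`ε = ∞` is vacuous, `ε = 0` means isometric to the background on the late region).
DHRT arXiv:2104.08222, §1 ("remains close to"); Klainerman–Szeftel, PAMQ 19 (2023),
Thm. 1.1. [cite: arXiv210408222] -/
def RemainsCloseTo (𝒟 : Set 𝓢.carrier) (k : ℕ) (ε : ℝ≥0∞) : Prop :=
  ∃ (τ₀ : ℝ) (Ψ : B.domain → 𝓢.carrier), 𝓢.IsLateEmbedding B 𝒟 τ₀ Ψ ∧
    ∀ τ, τ₀ ≤ τ → 𝓢.deviationCk B Ψ k τ ≤ ε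

variable {𝓢 B}

/-- Convergence in `Cᵏ'` implies convergence in `Cᵏ` for `k ≤ k'`
(DHRT arXiv:2104.08222, §1). [cite: arXiv210408222] -/
theorem ConvergesTo.of_le {𝒟 : Set 𝓢.carrier} {k k' : ℕ} (h : 𝓢.ConvergesTo B 𝒟 k')
    (hk : k ≤ k') : 𝓢.ConvergesTo B 𝒟 k := by
  obtain ⟨τ₀, Ψ, hΨ, ht⟩ := h
  refine ⟨τ₀, Ψ, hΨ, ?_⟩
  exact tendsto_of_tendsto_of_tendsto_of_le_of_le tendsto_const_nhds ht (fun _ ↦ zero_le)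
    fun τ ↦ 𝓢.deviationCk_mono B Ψ hk τ

/-- Convergence in `Cᵏ` implies near-zone (truncated) convergence for every `R`, in the same
chart (DHRT arXiv:2104.08222, §1). [cite: arXiv210408222] -/
theorem ConvergesTo.exists_tendsto_truncDeviationCk {𝒟 : Set 𝓢.carrier} {k : ℕ}
    (h : 𝓢.ConvergesTo B 𝒟 k) :
    ∃ (τ₀ : ℝ) (Ψ : B.domain → 𝓢.carrier), 𝓢.IsLateEmbedding B 𝒟 τ₀ Ψ ∧
      ∀ R, Tendsto (fun τ ↦ 𝓢.truncDeviationCk B Ψ k R τ) atTop (𝓝 0) := by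
  obtain ⟨τ₀, Ψ, hΨ, ht⟩ := h
  refine ⟨τ₀, Ψ, hΨ, fun R ↦ ?_⟩
  exact tendsto_of_tendsto_of_tendsto_of_le_of_le tendsto_const_nhds ht (fun _ ↦ zero_le)
    fun τ ↦ 𝓢.truncDeviationCk_le_deviationCk B Ψ k R τ

/-- `ε`-closeness is monotone in `ε` (DHRT arXiv:2104.08222, §1). [cite: arXiv210408222] -/
theorem RemainsCloseTo.mono {𝒟 : Set 𝓢.carrier} {k : ℕ} {ε ε' : ℝ≥0∞}
    (h : 𝓢.RemainsCloseTo B 𝒟 k ε) (hε : ε ≤ ε') : 𝓢.RemainsCloseTo B 𝒟 k ε' := by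
  obtain ⟨τ₀, Ψ, hΨ, hb⟩ := h
  exact ⟨τ₀, Ψ, hΨ, fun τ hτ ↦ (hb τ hτ).trans hε⟩

/-- Convergence implies eventual `ε`-closeness on slabs for every `ε > 0`, *in the same chart*:
a restatement of `Tendsto … (𝓝 0)` (DHRT arXiv:2104.08222, §1). [cite: arXiv210408222] -/
theorem ConvergesTo.eventually_le {𝒟 : Set 𝓢.carrier} {k : ℕ} (h : 𝓢.ConvergesTo B 𝒟 k)
    {ε : ℝ≥0∞} (hε : 0 < ε) :
    ∃ (τ₀ : ℝ) (Ψ : B.domain → 𝓢.carrier), 𝓢.IsLateEmbedding B 𝒟 τ₀ Ψ ∧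
      ∀ᶠ τ in atTop, 𝓢.deviationCk B Ψ k τ ≤ ε := by
  obtain ⟨τ₀, Ψ, hΨ, ht⟩ := h
  refine ⟨τ₀, Ψ, hΨ, ?_⟩
  exact (ht.eventually (ge_mem_nhds hε))

end Spacetime

/-! ### Kerr -/

namespace Kerr

/-- The **Kerr reference background** `(Kerr.exterior M a, g_{M,a}, t*)` in ingoing
Kerr–Schild Cartesian coordinates: domain `{r > max r₊ 0}` (`Kerr.exterior`; punctured only
for `M = a = 0`), Kerr–Schild form `Kerr.bilin M a`, time function `t* = x⁰`, radius the
Kerr–Schild `r = Kerr.radius a`. DHRT arXiv:2104.08222, §1; Dafermos–Rodnianski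
arXiv:0811.0354, §5.1. [cite: arXiv210408222] -/
def background (M a : ℝ) : ModelBackground where
  domain := exterior M a
  bilin := bilin M a
  time x := x 0
  radius := radius a

/-- The **late region** `{x ∈ Kerr.exterior M a | τ₀ < t*(x)}` of the Kerr exterior
(DHRT arXiv:2104.08222, §1). [cite: arXiv210408222] -/
def lateRegion (M a τ₀ : ℝ) : Set (exterior M a) := (background M a).lateRegion τ₀

/-- The **time slab** `{x ∈ Kerr.exterior M a | t*(x) = τ}` (DHRT arXiv:2104.08222, §1;
Dafermos–Rodnianski arXiv:0811.0354, §5.2, the `{t* = τ}` foliation). [cite: arXiv210408222] -/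
def timeSlab (M a τ : ℝ) : Set (exterior M a) := (background M a).timeSlab τ

/-- Membership in the Kerr late region (DHRT arXiv:2104.08222, §1). [cite: arXiv210408222] -/
@[simp]
theorem mem_lateRegion {M a τ₀ : ℝ} {x : exterior M a} : x ∈ lateRegion M a τ₀ ↔ τ₀ < x.1 0 :=
  Iff.rfl

/-- Membership in a Kerr time slab (DHRT arXiv:2104.08222, §1). [cite: arXiv210408222] -/
@[simp]
theorem mem_timeSlab {M a τ : ℝ} {x : exterior M a} : x ∈ timeSlab M a τ ↔ x.1 0 = τ :=
  Iff.rfl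

end Kerr

namespace Spacetime

variable (𝓢 : Spacetime.{u} 4)

/-- The **metric deviation from Kerr** `Ψ^* g − g_{M,a}` on `Kerr.exterior M a`, valued in
`E4 →L[ℝ] E4 →L[ℝ] ℝ` (DHRT arXiv:2104.08222, §1; Klainerman–Szeftel, PAMQ 19 (2023),
Thm. 1.1). [cite: arXiv210408222] -/
def metricDeviation (M a : ℝ) (Ψ : Kerr.exterior M a → 𝓢.carrier) :
    Kerr.exterior M a → E4 →L[ℝ] E4 →L[ℝ] ℝ :=
  𝓢.deviation (Kerr.background M a) Ψ

/-- Unfolding lemma (DHRT arXiv:2104.08222, §1). [cite: arXiv210408222] -/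
theorem metricDeviation_apply (M a : ℝ) (Ψ : Kerr.exterior M a → 𝓢.carrier)
    (x : Kerr.exterior M a) (v w : E4) :
    𝓢.metricDeviation M a Ψ x v w =
      𝓢.metric.val (Ψ x) (mfderiv 𝓘(ℝ, E4) (𝓡 4) Ψ x v) (mfderiv 𝓘(ℝ, E4) (𝓡 4) Ψ x w) -
        Kerr.bilin M a x.1 v w :=
  rfl

/-- **Convergence to the Kerr solution `g_{M,a}` in the region `𝒟`, in `Cᵏ`**, in the
Kerr–Schild pullback gauge: `ConvergesTo` for `Kerr.background M a`. Consequence-form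
paraphrase (module docstring) of DHRT arXiv:2104.08222, §1, Thm. (`|a| ≪ M`: Klainerman–Szeftel,
PAMQ 19 (2023), Thm. 1.1; Giorgi–Klainerman–Szeftel arXiv:2205.14808). "Converges to a nearby
Kerr solution" is `∃ M a` near the initial parameters with `ConvergesToKerr 𝓢 𝒟 M a k`. [cite: arXiv210408222] -/
def ConvergesToKerr (𝒟 : Set 𝓢.carrier) (M a : ℝ) (k : ℕ) : Prop :=
  𝓢.ConvergesTo (Kerr.background M a) 𝒟 k

/-- **`ε`-closeness to `g_{M,a}` in `𝒟`, in `Cᵏ`** (Kerr–Schild pullback gauge):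
`RemainsCloseTo` for `Kerr.background M a`. DHRT arXiv:2104.08222, §1. [cite: arXiv210408222] -/
def RemainsCloseToKerr (𝒟 : Set 𝓢.carrier) (M a : ℝ) (k : ℕ) (ε : ℝ≥0∞) : Prop :=
  𝓢.RemainsCloseTo (Kerr.background M a) 𝒟 k ε

end Spacetime

/-! ### Minkowski (no puncture: the domain is all of `E4`) -/

namespace Minkowski

/-- The **Minkowski reference background on an open set `U ⊆ E4`**: `(U, η, t = x⁰,
r = |x̲|)` (used for the radiation zone of `FinalStateDecomposition`, where the flat chart is
defined only on part of `E4`). Christodoulou–Klainerman 1993, Thm. 1.0.2; Lindblad–Rodnianski,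
Ann. Math. 171 (2010), Thm. 1.1. [cite: ChristodoulouKlainerman1993, Thm. 1.0.2] -/
def backgroundOn (U : Opens E4) : ModelBackground where
  domain := U
  bilin _ := bilin
  time x := x 0
  radius := E4.spatialNorm

/-- The **Minkowski reference background** `(E4, η, t = x⁰, r = |x̲|)` on all of `E4` (no
axis puncture, review F3): `backgroundOn ⊤`. Christodoulou–Klainerman 1993, Thm. 1.0.2;
Lindblad–Rodnianski, Ann. Math. 171 (2010), Thm. 1.1. [cite: ChristodoulouKlainerman1993, Thm. 1.0.2] -/
def background : ModelBackground := backgroundOn ⊤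

/-- The **late region** `{x ∈ E4 | τ₀ < x⁰}` of Minkowski space (Christodoulou–Klainerman
1993, Ch. 1). [folklore] -/
def lateRegion (τ₀ : ℝ) : Set E4 := {x | τ₀ < x 0}

/-- The **time slab** `{x ∈ E4 | x⁰ = τ}` of Minkowski space (Christodoulou–Klainerman 1993,
Ch. 1). [cite: ChristodoulouKlainerman1993, Ch. 1] -/
def timeSlab (τ : ℝ) : Set E4 := {x | x 0 = τ}

/-- The generic late region of `Minkowski.background` is `Minkowski.lateRegion` (as subsets of
`E4`). Christodoulou–Klainerman 1993, Ch. 1. [cite: ChristodoulouKlainerman1993, Ch. 1] -/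
@[simp]
theorem image_lateRegion_background (τ₀ : ℝ) :
    Subtype.val '' background.lateRegion τ₀ = lateRegion τ₀ := by
  ext x
  simp only [Set.mem_image, ModelBackground.mem_lateRegion, lateRegion, Set.mem_setOf_eq]
  exact ⟨fun ⟨y, hy, hyx⟩ ↦ hyx ▸ hy, fun hx ↦ ⟨⟨x, trivial⟩, hx, rfl⟩⟩

/-- The generic time slab of `Minkowski.background` is `Minkowski.timeSlab`.
Christodoulou–Klainerman 1993, Ch. 1. [cite: ChristodoulouKlainerman1993, Ch. 1] -/
@[simp]
theorem image_timeSlab_background (τ : ℝ) :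
    Subtype.val '' background.timeSlab τ = timeSlab τ := by
  ext x
  simp only [Set.mem_image, ModelBackground.mem_timeSlab, timeSlab, Set.mem_setOf_eq]
  exact ⟨fun ⟨y, hy, hyx⟩ ↦ hyx ▸ hy, fun hx ↦ ⟨⟨x, trivial⟩, hx, rfl⟩⟩

end Minkowski

namespace Spacetime

variable (𝓢 : Spacetime.{u} 4)

/-- The **metric deviation from Minkowski** `Ψ^* g − η` of a chart map `Ψ : E4 → 𝓢.carrier`
defined on all of `E4` (Christodoulou–Klainerman 1993, Thm. 1.0.2; Lindblad–Rodnianski 2010,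
Thm. 1.1: `h = g − m` in wave coordinates). [cite: ChristodoulouKlainerman1993, Thm. 1.0.2] -/
def minkowskiDeviation (Ψ : E4 → 𝓢.carrier) (x : E4) : E4 →L[ℝ] E4 →L[ℝ] ℝ :=
  (show E4 →L[ℝ] E4 →L[ℝ] ℝ from
      pullbackBilin (I := 𝓡 4) (I' := 𝓘(ℝ, E4)) Ψ 𝓢.metric.val x) - Minkowski.bilin

/-- Unfolding lemma (Lindblad–Rodnianski 2010, Thm. 1.1). [cite: LindbladRodnianski2010, Thm. 1.1] -/
theorem minkowskiDeviation_apply (Ψ : E4 → 𝓢.carrier) (x v w : E4) :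
    𝓢.minkowskiDeviation Ψ x v w =
      𝓢.metric.val (Ψ x) (mfderiv 𝓘(ℝ, E4) (𝓡 4) Ψ x v) (mfderiv 𝓘(ℝ, E4) (𝓡 4) Ψ x w) -
        Minkowski.bilin v w :=
  rfl

/-- The generic deviation from `Minkowski.background` of `Ψ ∘ Subtype.val` (chart map
restricted to the open submanifold `⊤ ⊆ E4`) is `minkowskiDeviation Ψ`: the inclusion of an
open submanifold has differential the identity under `T_x ⊤ = E4 = T_{x} E4`, and Mathlib's
junk values (`mfderiv = 0` at non-differentiable points) match on both sides. Lee,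
*Introduction to Smooth Manifolds*, Prop. 3.9; Christodoulou–Klainerman 1993, Thm. 1.0.2. [cite: ChristodoulouKlainerman1993, Thm. 1.0.2] -/
def deviation_minkowskiBackground_comp_subtypeVal : Prop :=
  ∀ (Ψ : E4 → 𝓢.carrier) (x : Minkowski.background.domain),
    𝓢.deviation Minkowski.background (Ψ ∘ Subtype.val) x = 𝓢.minkowskiDeviation Ψ x.1

/-- **Convergence to Minkowski space in the region `𝒟`, in `Cᵏ`**: `ConvergesTo` for
`Minkowski.background` (domain all of `E4`). Consequence-form paraphrase of
Christodoulou–Klainerman 1993, Thm. 1.0.2 / 10.2.1 and Lindblad–Rodnianski, Ann. Math. 171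
(2010), Thm. 1.1. [cite: ChristodoulouKlainerman1993, Thm. 1.0.2 / 10.2.1 and Lindblad–Rodnian] -/
def ConvergesToMinkowski (𝒟 : Set 𝓢.carrier) (k : ℕ) : Prop :=
  𝓢.ConvergesTo Minkowski.background 𝒟 k

/-- **`ε`-closeness to Minkowski space in `𝒟`, in `Cᵏ`**: `RemainsCloseTo` for
`Minkowski.background`. Christodoulou–Klainerman 1993, Thm. 1.0.2. [cite: ChristodoulouKlainerman1993, Thm. 1.0.2] -/
def RemainsCloseToMinkowski (𝒟 : Set 𝓢.carrier) (k : ℕ) (ε : ℝ≥0∞) : Prop :=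
  𝓢.RemainsCloseTo Minkowski.background 𝒟 k ε

end Spacetime

/-! ### The Lorentz group, boosted Kerr, and the `N`-black-hole final state -/

/-- The **Lorentz group** `O(1,3)`: the subgroup of continuous linear automorphisms `Λ` of
`E4` preserving the Minkowski form, `η(Λv, Λw) = η(v, w)` (group structure
`ContinuousLinearEquiv.automorphismGroup`, `(Λ * Λ') v = Λ (Λ' v)`). Each element is an
isometric equivalence of `(E4, η)` in Mathlib's sense `LinearMap.BilinForm.IsometryEquiv`
(the plain function `lorentzGroup.isometryEquiv Λ`; no dot notation, the head symbol of
`Λ : ↥lorentzGroup` being `Subtype`). O'Neill 1983, Ch. 9, pp. 233–236. [cite: ONeill1983, Ch. 9  pp. 233–236] -/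
def lorentzGroup : Subgroup (E4 ≃L[ℝ] E4) where
  carrier := {Λ | ∀ v w, Minkowski.bilin (Λ v) (Λ w) = Minkowski.bilin v w}
  mul_mem' {Λ Λ'} hΛ hΛ' v w := (hΛ (Λ' v) (Λ' w)).trans (hΛ' v w)
  one_mem' _ _ := rfl
  inv_mem' {Λ} hΛ v w := by
    have h := hΛ (Λ.symm v) (Λ.symm w)
    rw [Λ.apply_symm_apply, Λ.apply_symm_apply] at h
    exact h.symm

/-- Membership in the Lorentz group (O'Neill 1983, Ch. 9, p. 233). [cite: ONeill1983, Ch. 9  p. 233] -/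
theorem mem_lorentzGroup_iff {Λ : E4 ≃L[ℝ] E4} :
    Λ ∈ lorentzGroup ↔ ∀ v w, Minkowski.bilin (Λ v) (Λ w) = Minkowski.bilin v w :=
  Iff.rfl

/-- A Lorentz transformation as an isometric equivalence of the bilinear space `(E4, η)` in
Mathlib's sense (`LinearMap.BilinForm.IsometryEquiv`). O'Neill 1983, Ch. 9, p. 233. [cite: ONeill1983, Ch. 9  p. 233] -/
def lorentzGroup.isometryEquiv (Λ : lorentzGroup) :
    LinearMap.BilinForm.IsometryEquiv (R := ℝ) (M₁ := E4) (M₂ := E4)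
      Minkowski.bilin.toLinearMap₁₂ Minkowski.bilin.toLinearMap₁₂ where
  toLinearEquiv := (Λ : E4 ≃L[ℝ] E4).toLinearEquiv
  map_app' v w := Λ.2 v w

/-- The **inverse Poincaré map** `x ↦ Λ⁻¹ (x − c)` of the motion `(Λ, c)`, as a continuous
affine self-map of `E4` (rest-frame coordinates of an observer boosted by `Λ` and translated
by `c`). O'Neill 1983, Ch. 9, p. 236. [cite: ONeill1983, Ch. 9  p. 236] -/
def poincareInv (Λ : lorentzGroup) (c : E4) (x : E4) : E4 := (Λ : E4 ≃L[ℝ] E4).symm (x - c)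

/-- The inverse Poincaré map is continuous (O'Neill 1983, Ch. 9). [cite: ONeill1983, Ch. 9] -/
theorem continuous_poincareInv (Λ : lorentzGroup) (c : E4) : Continuous (poincareInv Λ c) :=
  (Λ : E4 ≃L[ℝ] E4).symm.continuous.comp (continuous_id.sub continuous_const)

/-- The **boosted, translated Kerr exterior** `{x ∈ E4 | Λ⁻¹(x − c) ∈ Kerr.exterior M a}`,
an open subset of `E4` (preimage of `Kerr.exterior` under the inverse Poincaré map).
Final state conjecture folklore: Klainerman, "Brief history of the black hole stability
problem", §4. [folklore] -/
def boostedKerrExterior (Λ : lorentzGroup) (c : E4) (M a : ℝ) : Opens E4 :=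
  ⟨poincareInv Λ c ⁻¹' (Kerr.exterior M a : Set E4),
    (Kerr.exterior M a).isOpen.preimage (continuous_poincareInv Λ c)⟩

/-- Membership in the boosted Kerr exterior (Klainerman, §4). [folklore] -/
@[simp]
theorem mem_boostedKerrExterior {Λ : lorentzGroup} {c : E4} {M a : ℝ} {x : E4} :
    x ∈ boostedKerrExterior Λ c M a ↔ poincareInv Λ c x ∈ Kerr.exterior M a :=
  Iff.rfl

/-- The **boosted, translated Kerr–Schild form**: the pullback of `Kerr.bilin M a` under the
inverse Poincaré map, `(v, w) ↦ g_{M,a}(Λ⁻¹(x − c))(Λ⁻¹ v, Λ⁻¹ w)`. Total on `E4` because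
`Kerr.bilin` is; only its values on `boostedKerrExterior Λ c M a` are meaningful (no junk
branch needed). Kerr–Schild 1965 (Lorentz covariance of the Kerr–Schild ansatz);
Klainerman, §4. [cite: KerrSchild1965, (Lorentz covariance of the Kerr–Schild a] -/
def boostedKerrBilin (Λ : lorentzGroup) (c : E4) (M a : ℝ) (x : E4) : E4 →L[ℝ] E4 →L[ℝ] ℝ :=
  (ContinuousLinearMap.precomp ℝ ((Λ : E4 ≃L[ℝ] E4).symm : E4 →L[ℝ] E4)).comp
    ((Kerr.bilin M a (poincareInv Λ c x)).comp ((Λ : E4 ≃L[ℝ] E4).symm : E4 →L[ℝ] E4))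

/-- Unfolding lemma: `boostedKerrBilin Λ c M a x v w = g_{M,a}(Λ⁻¹(x − c))(Λ⁻¹ v, Λ⁻¹ w)`
(Kerr–Schild 1965). Not `@[simp]`, so that `boostedKerrBilin_one_zero` fires on applied terms. [cite: KerrSchild1965] -/
theorem boostedKerrBilin_apply (Λ : lorentzGroup) (c : E4) (M a : ℝ) (x v w : E4) :
    boostedKerrBilin Λ c M a x v w =
      Kerr.bilin M a (poincareInv Λ c x) ((Λ : E4 ≃L[ℝ] E4).symm v)
        ((Λ : E4 ≃L[ℝ] E4).symm w) :=
  rfl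

/-- With the trivial motion `(1, 0)` the boosted form is the Kerr–Schild form
(Kerr–Schild 1965). [cite: KerrSchild1965] -/
@[simp]
theorem boostedKerrBilin_one_zero (M a : ℝ) (x : E4) :
    boostedKerrBilin 1 0 M a x = Kerr.bilin M a x := by
  ext v w
  rw [boostedKerrBilin_apply, poincareInv, sub_zero]
  rfl

/-- The **boosted Kerr reference background**: domain `boostedKerrExterior Λ c M a`, form
`boostedKerrBilin Λ c M a`, time function the rest-frame Kerr–Schild time
`t*(x) = (Λ⁻¹(x − c))⁰`, radius the rest-frame Kerr–Schild radius `r(Λ⁻¹(x − c))`.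
Klainerman, "Brief history of the black hole stability problem", §4 (no printed formulation;
see the module docstring). [folklore] -/
def boostedKerrBackground (Λ : lorentzGroup) (c : E4) (M a : ℝ) : ModelBackground where
  domain := boostedKerrExterior Λ c M a
  bilin := boostedKerrBilin Λ c M a
  time x := poincareInv Λ c x 0
  radius x := Kerr.radius a (poincareInv Λ c x)

namespace Spacetime

variable (𝓢 : Spacetime.{u} 4)

/-- **Convergence to the boosted, translated Kerr solution** with motion `(Λ, c)` and
parameters `(M, a)` in the region `𝒟`, in `Cᵏ`: `ConvergesTo` for `boostedKerrBackground`.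
Folklore final state conjecture (Penrose 1982, Problem 12; Klainerman, §4); for `(Λ, c) =
(1, 0)` this is `ConvergesToKerr` up to the definitional unfolding `boostedKerrBilin_one_zero`. [cite: Penrose1982, Problem 12] -/
def ConvergesToBoostedKerr (𝒟 : Set 𝓢.carrier) (Λ : lorentzGroup) (c : E4) (M a : ℝ)
    (k : ℕ) : Prop :=
  𝓢.ConvergesTo (boostedKerrBackground Λ c M a) 𝒟 k

end Spacetime

/-- **Hypothesis structure: `N`-black-hole final state decomposition** of the region
`𝒟 ⊆ 𝓢.carrier`, in `Cᵏ`. The folklore final state conjecture (Penrose 1982, Problem 12;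
Klainerman, "Brief history of the black hole stability problem", §4) asserts that generic
asymptotically flat vacuum developments settle down, in their exterior, to finitely many
Kerr black holes moving apart plus radiation dispersing to Minkowski space.
**No printed formulation for `N ≥ 2` exists**; this structure records the data such a statement
consumes (module docstring, "Design choices"): the number `N`; masses/spins with `0 < Mᵢ`,
`|aᵢ| ≤ Mᵢ` (gr.S01 text; note H21's `Kerr.IsSubextremal` is the *strict* `|a| < M`, not
required here); motions `(Λᵢ, cᵢ)`; a common late time `τ₀`; late-time charts `chart i` on the
boosted Kerr exteriors and a flat chart `flatChart` on `flatDomain ⊆ E4` (all `IsLateChart`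
into `𝒟`); near-zone `Cᵏ` convergence to boosted Kerr on every truncated slab; separation of
the holes; sublinearly growing excision radii `ρᵢ` such that the flat domain contains the
whole late half-space `{x⁰ > τ₀}` minus the excised tubes `{rᵢ(Λᵢ⁻¹(x − cᵢ)) ≤ ρᵢ(x⁰)}`
around the straight world-lines of the holes in the flat chart (this is what gives the motions
`(Λᵢ, cᵢ)` their meaning, and it forces the flat slabs to be entire late half-spaces when
`N = 0`, so that "convergence" cannot be made vacuous by a flat domain bounded in time); full
`Cᵏ` convergence to `η` on the flat chart; and one global covering clause. Deviation from the
outline signature `FinalStateDecomposition 𝓢 𝒟`: `k` is a parameter so that gr.S01 can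
quantify over it. Everything is a real definition. [cite: Penrose1982, Problem 12] -/
structure FinalStateDecomposition (𝓢 : Spacetime.{u} 4) (𝒟 : Set 𝓢.carrier) (k : ℕ) where
  /-- The number of final black holes. -/
  N : ℕ
  /-- The final masses `Mᵢ`. -/
  mass : Fin N → ℝ
  /-- The final specific angular momenta `aᵢ`. -/
  spin : Fin N → ℝ
  /-- Each final mass is positive, `0 < Mᵢ`. -/
  mass_pos : ∀ i, 0 < mass i
  /-- Each final black hole is Kerr with `|aᵢ| ≤ Mᵢ` (extremality not excluded, as in the
  informal gr.S01). -/
  abs_spin_le_mass : ∀ i, |spin i| ≤ mass i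
  /-- The asymptotic motion `(Λᵢ, cᵢ)` (boost/rotation and translation) of black hole `i`. -/
  motion : Fin N → lorentzGroup × E4
  /-- The common initial late time `τ₀` of all charts. -/
  τ₀ : ℝ
  /-- The late-time chart of black hole `i`, on the boosted Kerr exterior
  `boostedKerrExterior Λᵢ cᵢ Mᵢ aᵢ`. -/
  chart : ∀ i, boostedKerrExterior (motion i).1 (motion i).2 (mass i) (spin i) → 𝓢.carrier
  /-- Each `chart i` is a late-time chart into `𝒟` after `τ₀`. -/
  isLateChart : ∀ i, 𝓢.IsLateChart
    (boostedKerrBackground (motion i).1 (motion i).2 (mass i) (spin i)) 𝒟 τ₀ (chart i)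
  /-- Near-zone convergence: for every `R`, the `Cᵏ` deviation of `(chart i)^* g` from boosted
  Kerr `(Mᵢ, aᵢ, Λᵢ, cᵢ)` on the truncated slabs `{t*ᵢ = τ, rᵢ ≤ R}` tends to `0`. -/
  tendsto_truncDeviationCk : ∀ i (R : ℝ), Tendsto (fun τ ↦ 𝓢.truncDeviationCk
    (boostedKerrBackground (motion i).1 (motion i).2 (mass i) (spin i)) (chart i) k R τ)
    atTop (𝓝 0)
  /-- The holes separate: for every `R` there is `τ₁` after which the truncated world-tubes
  `chart i '' {t*ᵢ > τ₁, rᵢ ≤ R}` are pairwise disjoint. -/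
  exists_pairwise_disjoint : ∀ R : ℝ, ∃ τ₁ : ℝ, Pairwise (Function.onFun Disjoint fun i ↦
    chart i '' (boostedKerrBackground (motion i).1 (motion i).2 (mass i) (spin i)
      |>.truncLateRegion τ₁ R))
  /-- The excision radius `ρᵢ(t)` of the near-zone tube of hole `i` at flat time `t`. -/
  excision : Fin N → ℝ → ℝ
  /-- The excision radii grow sublinearly, `ρᵢ(t) / t → 0` (near zones stay inside the light
  cone; any `ρᵢ → ∞` with `ρᵢ = o(t)` accommodates the expected `O(Mᵢ/ρᵢ)` far fields). -/
  tendsto_excision_div : ∀ i, Tendsto (fun t ↦ excision i t / t) atTop (𝓝 0)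
  /-- The coordinate domain `U₀ ⊆ E4` of the flat (radiation-zone) chart. -/
  flatDomain : Opens E4
  /-- The flat domain contains the late half-space `{x⁰ > τ₀}` minus the excised tubes
  `{rᵢ(Λᵢ⁻¹(x − cᵢ)) ≤ ρᵢ(x⁰)}` around the holes' straight world-lines. -/
  setOf_lt_excision_subset_flatDomain :
    {x : E4 | τ₀ < x 0 ∧ ∀ i, excision i (x 0) <
      Kerr.radius (spin i) (poincareInv (motion i).1 (motion i).2 x)} ⊆ flatDomain
  /-- The flat (radiation-zone) chart. -/
  flatChart : flatDomain → 𝓢.carrier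
  /-- The flat chart is a late-time chart into `𝒟` after `τ₀` (Minkowski background on
  `flatDomain`, time `x⁰`). -/
  isLateChart_flat : 𝓢.IsLateChart (Minkowski.backgroundOn flatDomain) 𝒟 τ₀ flatChart
  /-- Radiation zone: the full `Cᵏ` deviation of `flatChart^* g` from `η` on the slabs
  `{x⁰ = τ} ∩ U₀` tends to `0`. -/
  tendsto_deviationCk_flat :
    Tendsto (fun τ ↦ 𝓢.deviationCk (Minkowski.backgroundOn flatDomain) flatChart k τ)
      atTop (𝓝 0)
  /-- Global covering clause: the part of `𝒟` not covered by the late images of the `N + 1`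
  charts lies in the causal past of the images of their initial slabs `{t = τ₀}`. -/
  diff_subset_causalPast :
    𝒟 \ ((⋃ i, chart i '' (boostedKerrBackground (motion i).1 (motion i).2 (mass i)
        (spin i)).lateRegion τ₀) ∪
        flatChart '' (Minkowski.backgroundOn flatDomain).lateRegion τ₀) ⊆
      𝓢.metric.causalPast 𝓢.timeOrientation
        ((⋃ i, chart i '' (boostedKerrBackground (motion i).1 (motion i).2 (mass i)
          (spin i)).timeSlab τ₀) ∪
          flatChart '' (Minkowski.backgroundOn flatDomain).timeSlab τ₀)

namespace FinalStateDecomposition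

variable {𝓢 : Spacetime.{u} 4} {𝒟 : Set 𝓢.carrier} {k : ℕ}

/-- The reference background of black hole `i` (boosted Kerr `(Mᵢ, aᵢ)` with motion
`(Λᵢ, cᵢ)`). Klainerman, §4. [folklore] -/
def background (d : FinalStateDecomposition 𝓢 𝒟 k) (i : Fin d.N) : ModelBackground :=
  boostedKerrBackground (d.motion i).1 (d.motion i).2 (d.mass i) (d.spin i)

/-- The **black-hole region** of hole `i`: the image of the late boosted Kerr exterior
`{t*ᵢ > τ₀}` under `chart i` (a subset of `𝒟`). Klainerman, §4. [folklore] -/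
def region (d : FinalStateDecomposition 𝓢 𝒟 k) (i : Fin d.N) : Set 𝓢.carrier :=
  d.chart i '' (d.background i).lateRegion d.τ₀

/-- The **radiation zone**: the image of the late flat domain `{x⁰ > τ₀} ∩ U₀` under the flat
chart (a subset of `𝒟`). Klainerman, §4; Christodoulou–Klainerman 1993, Thm. 1.0.2. [cite: ChristodoulouKlainerman1993, Thm. 1.0.2] -/
def radiationZone (d : FinalStateDecomposition 𝓢 𝒟 k) : Set 𝓢.carrier :=
  d.flatChart '' (Minkowski.backgroundOn d.flatDomain).lateRegion d.τ₀

/-- Each black-hole region lies in `𝒟` (Klainerman, §4). [folklore] -/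
theorem region_subset (d : FinalStateDecomposition 𝓢 𝒟 k) (i : Fin d.N) : d.region i ⊆ 𝒟 :=
  (d.isLateChart i).image_subset

/-- The radiation zone lies in `𝒟` (Klainerman, §4). [folklore] -/
theorem radiationZone_subset (d : FinalStateDecomposition 𝓢 𝒟 k) : d.radiationZone ⊆ 𝒟 :=
  d.isLateChart_flat.image_subset

/-- Anti-vacuity (`N = 0`): with no black hole the flat domain contains the whole late
half-space `{x⁰ > τ₀}`, so every late flat slab is an entire `{x⁰ = τ} ≅ ℝ³` and the
radiation-zone convergence is the honest one of `ConvergesToMinkowski` (review of attempt 2,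
item 1: no time-bounded or empty flat domain). Christodoulou–Klainerman 1993, Thm. 1.0.2. [cite: ChristodoulouKlainerman1993, Thm. 1.0.2] -/
theorem lateRegion_subset_flatDomain_of_N_eq_zero (d : FinalStateDecomposition 𝓢 𝒟 k)
    (hN : d.N = 0) : Minkowski.lateRegion d.τ₀ ⊆ (d.flatDomain : Set E4) := fun _ hx ↦
  d.setOf_lt_excision_subset_flatDomain ⟨hx, fun i ↦ (hN ▸ i).elim0⟩

/-- Anti-vacuity (`N = 0`, `𝒟` nonempty is forced to be charted): with no black hole, every
point of `𝒟` outside the radiation zone lies in the causal past of the image of the initial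
flat slab; in particular an empty radiation zone forces `𝒟 = ∅` (`J⁻(∅) = ∅`).
O'Neill 1983, Ch. 14, p. 403. [cite: ONeill1983, Ch. 14  p. 403] -/
theorem diff_radiationZone_subset_of_N_eq_zero (d : FinalStateDecomposition 𝓢 𝒟 k)
    (hN : d.N = 0) :
    𝒟 \ d.radiationZone ⊆ 𝓢.metric.causalPast 𝓢.timeOrientation
      (d.flatChart '' (Minkowski.backgroundOn d.flatDomain).timeSlab d.τ₀) := by
  have hcov := d.diff_subset_causalPast
  haveI : IsEmpty (Fin d.N) := hN ▸ Fin.isEmpty'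
  rwa [Set.iUnion_of_empty, Set.iUnion_of_empty, Set.empty_union, Set.empty_union] at hcov

/-- Sanity (`N = 0`): a decomposition with no black hole whose flat chart is defined on all
of `E4` is exactly convergence to Minkowski space in `𝒟` (used by gr.S01
`FinalStateConjectureN01`). Christodoulou–Klainerman 1993, Thm. 1.0.2. [cite: ChristodoulouKlainerman1993, Thm. 1.0.2] -/
theorem convergesToMinkowski_of_N_eq_zero (d : FinalStateDecomposition 𝓢 𝒟 k)
    (hN : d.N = 0) (hU : d.flatDomain = ⊤) : 𝓢.ConvergesToMinkowski 𝒟 k := by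
  obtain ⟨N, mass, spin, _, _, motion, τ₀, chart, _, _, _, _, _, U, _, Ψ, hΨ, ht, hcov⟩ := d
  subst hU
  cases hN
  refine ⟨τ₀, Ψ, ⟨hΨ, ?_⟩, ht⟩
  rw [Set.iUnion_of_empty, Set.empty_union, Set.iUnion_of_empty, Set.empty_union] at hcov
  exact hcov

/-- Sanity (`N = 0`, converse): convergence to Minkowski space in `𝒟` gives a decomposition
with no black hole and flat chart on all of `E4` (Christodoulou–Klainerman 1993, Thm. 1.0.2).
Uses choice to extract the chart. [cite: ChristodoulouKlainerman1993, Thm. 1.0.2] -/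
def ofConvergesToMinkowski (h : 𝓢.ConvergesToMinkowski 𝒟 k) :
    FinalStateDecomposition 𝓢 𝒟 k where
  N := 0
  mass := Fin.elim0
  spin := Fin.elim0
  mass_pos i := i.elim0
  abs_spin_le_mass i := i.elim0
  motion := Fin.elim0
  τ₀ := h.choose
  chart i := i.elim0
  isLateChart i := i.elim0
  tendsto_truncDeviationCk i := i.elim0
  exists_pairwise_disjoint _ := ⟨0, fun i ↦ i.elim0⟩
  excision := Fin.elim0
  tendsto_excision_div i := i.elim0
  flatDomain := ⊤
  setOf_lt_excision_subset_flatDomain _ _ := trivial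
  flatChart := h.choose_spec.choose
  isLateChart_flat := h.choose_spec.choose_spec.1.toIsLateChart
  tendsto_deviationCk_flat := h.choose_spec.choose_spec.2
  diff_subset_causalPast := by
    rw [Set.iUnion_of_empty, Set.empty_union, Set.iUnion_of_empty, Set.empty_union]
    exact h.choose_spec.choose_spec.1.diff_subset_causalPast

/-- `ofConvergesToMinkowski` has no black hole (Christodoulou–Klainerman 1993, Thm. 1.0.2). [cite: ChristodoulouKlainerman1993, Thm. 1.0.2] -/
@[simp]
theorem ofConvergesToMinkowski_N (h : 𝓢.ConvergesToMinkowski 𝒟 k) :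
    (ofConvergesToMinkowski h).N = 0 := rfl

/-- `ofConvergesToMinkowski` has flat chart on all of `E4` (Christodoulou–Klainerman 1993,
Thm. 1.0.2). [cite: ChristodoulouKlainerman1993, Thm. 1.0.2] -/
@[simp]
theorem ofConvergesToMinkowski_flatDomain (h : 𝓢.ConvergesToMinkowski 𝒟 k) :
    (ofConvergesToMinkowski h).flatDomain = ⊤ := rfl

end FinalStateDecomposition

/-- Sanity (`N = 1`): convergence to Kerr `(M, a)` with `0 < M`, `|a| ≤ M` in `𝒟` yields a
one-black-hole decomposition: motion `(1, 0)` (the boosted exterior for `(1, 0)` is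
`Kerr.exterior` since `poincareInv 1 0 = id`), hole chart the Kerr chart `Ψ` (truncated
convergence follows from full convergence by `truncDeviationCk_le_deviationCk`, separation
is vacuous for one hole), excision `ρ(t) = √t`, flat domain `{x⁰ > τ₀, r > √x⁰}` with flat
chart `Ψ` restricted to it (there `Ψ^*g − η = (Ψ^*g − g_{M,a}) + (g_{M,a} − η)` and the
Kerr–Schild term `g_{M,a} − η = H ℓ⊗ℓ` is `O(M/r^{1+m})` in `Cᵐ`, hence `→ 0` on `{r > √τ}`),
and the covering clause is `IsLateEmbedding.diff_subset_causalPast`.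
DHRT arXiv:2104.08222, §1; used by gr.S01 `FinalStateConjectureN01`. [cite: arXiv210408222] -/
def nonempty_finalStateDecomposition_of_convergesToKerr : Prop :=
  ∀ {𝓢 : Spacetime.{u} 4} {𝒟 : Set 𝓢.carrier} {M a : ℝ} {k : ℕ} (h : 𝓢.ConvergesToKerr 𝒟 M a k) (hM : 0 < M) (ha : |a| ≤ M),
    Nonempty (FinalStateDecomposition 𝓢 𝒟 k)

end Literature.Geometry.Lorentzian

end
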